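import Mathlib
import HarnessLib
import Summits.NavierStokesRegularity.NavierStokesRegularity.Theorems.PoloidalWindowDoorPoloidalWindowRigidityTimeHeightShearPressure
import Summits.NavierStokesRegularity.NavierStokesRegularity.Theorems.PoloidalWindowDoorLrcModEntireQ4SonicHotSheetJet
import Summits.NavierStokesRegularity.NavierStokesRegularity.Theorems.PoloidalWindowDoorPoloidalWindowRigidityLeafUniformHFlat

/-!
# Route `PoloidalWindowDoor`, item `LrcModEntire` (stmt-NavierStokesRegularity-20428), cell (Q4-sonic), slot `stub_Q4sonicLineNeg`, case I —
# S4c (class-level half): THE (TH)-COLUMN TRANSPORT LAW FOR `g = ∂_eU₂` — the second-order row (E3) of the LEAD's mixed system, in invariant form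

Cell ns-regularity-ideate, helper seat ns-k2-port-2 g8 under the LEAD of item 20428 (ns-poloidal-K2-p3 g17, memo `T2B-g17.md` v4 §7 S4, simplified 19:33Z: unknowns
`g = ∂_eU₂`, `P = ⟪∂_eU_h, e⟫`, `Q = ⟪∂_eU_h, Je⟫`); `--supports stmt-NavierStokesRegularity-20428 --as helper`.

For a profile `v` of the route's Type-I class (poloidal), the (TH) slab law `∂_zv_b = μ(t,z)∂_bv₂` near `(t,x)` (`b = 0,1`) and a HORIZONTAL direction `e`:
* ★★ `horizDeriv_two_transport_law` — with `g(s,y) := D(v s)(y)[e]₂ = ∂_e v₂`, `μ = μ(t,x₂)`, `μ_t, μ_z, μ_zz` its derivatives: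
  **`(1 − μ)·(∂ₜg + Dg[v] − Δg + (Dv[Dv e])₂)(t,x) = (μ_t + v₂μ_z − μ_zz)·g − 2μ_z·∂_z g`** — the K2-lead velocity-gradient law
  `…VelocityGradientLaw.fderiv_equation_coord` (`∂ₜ(∂_ev₂) + v·∇(∂_ev₂) − Δ(∂_ev₂) = ∂_e f₂ − (Dv Dv e)₂`, `f = ∂ₜv + (v·∇)v − Δv`) combined with the
  (TH) pressure identity `…TimeHeightShearPressure.timeHeightShear_pressure` (`(1−μ)∂_bf₂ = (μ_t + v₂μ_z − μ_zz)∂_bv₂ − 2μ_z∂_z∂_bv₂`, `b = 0,1`), by linearity in `e`.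
  Valid at EVERY point (no criticality) — on the web sheet it specialises to port-2's `normalDeriv_timeDeriv_of_horizCritical`.
* `coupling_frame` — the zeroth-order coupling in the web frame: `(Dv[Dv e])₂ = ⟪Dv e, e⟫·∂_ev₂ + ⟪Dv e, Je⟫·∂_{Je}v₂ + (Dv e)₂·∂_zv₂ = P·g + Q·θ_ν + g·θ_z`
  (`e` a horizontal unit vector; `…Q4SonicHotSheetJet.frame_decomp`).
In the sheared coordinates of `…ShearedCoordinates` (`(∂_t′ − d_t∂_m)`, `(∂_z′ − d_z∂_m)`, `∂_s² + ∂_m²` for `Δₕ`) this is the row `∂_m²g = …` of the hstep of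
`…SheetSystemUniqueness.vanishesToOrder_all_of_mixedSystem`; the pull-back wiring (S4c, second half) is left to the successor.
WHAT THIS IS NOT: not a claim about Navier–Stokes regularity — an identity of the (TH) column for the research slot `stub_Q4sonicLineNeg` (registry twist_split v13);
no stub is closed here; items 20428 / 19708 / 27893 OPEN.
-/

noncomputable section

set_option linter.dupNamespace false
set_option linter.style.longLine false

namespace Summit.NavierStokesRegularity.NavierStokesRegularity.Theorems.PoloidalWindowDoorLrcModEntireHorizDerivTransportLaw

open Set Function Filter Topology Metric
open scoped RealInnerProductSpace InnerProductSpace Laplacian ContDiff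
open Literature.Analysis Literature.Analysis.FluidPDE
open Summit.NavierStokesRegularity.NavierStokesRegularity.Theorems.LocalSineTubeDoorProfileAlignedWindowRigidityAncient
open Summit.NavierStokesRegularity.NavierStokesRegularity.Theorems.PoloidalWindowDoorPoloidalWindowRigidityWindow
open Summit.NavierStokesRegularity.NavierStokesRegularity.Theorems.PoloidalWindowDoorPoloidalWindowRigidityVelocityGradientLaw
open Summit.NavierStokesRegularity.NavierStokesRegularity.Theorems.PoloidalWindowDoorPoloidalWindowRigidityTimeHeightShearPressure
open Summit.NavierStokesRegularity.NavierStokesRegularity.Theorems.PoloidalWindowDoorLrcModEntireSheetFlattenTools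
open Summit.NavierStokesRegularity.NavierStokesRegularity.Theorems.PoloidalWindowDoorLrcModEntireQ4SonicHotSheetJet

variable {C : ℝ} {v : ℝ → EuclideanSpace ℝ (Fin 3) → EuclideanSpace ℝ (Fin 3)}

/-- ★★ **THE (TH)-COLUMN TRANSPORT LAW FOR `g = ∂_e v₂` (invariant form of the row (E3), every point).**  Class profile `v` (Type-I ancient mild, poloidal),
slab law with slope `μ` near `(t,x)`, `μ(t,·) ∈ C²`, `∂ₜμ(·,x₂)` exists at `t`, `e` horizontal:
`(1 − μ)·(∂ₜg + Dg[v] − Δg + (Dv[Dv e])₂) = (μ_t + v₂μ_z − μ_zz)·g − 2μ_z·∂_z g` at `(t,x)`, with `g(s,y) = D(v s)(y)[e]₂`. -/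
theorem horizDeriv_two_transport_law (hrate : HasTypeITimeDecay C v) (hcont : ContinuousOn (uncurry v) (Iio (0 : ℝ) ×ˢ univ))
    (hmild : ∀ s t : ℝ, s < t → t < 0 → ∀ x, v t x = UnboundedOperators.heatExtension (v s) (t - s) x - oseenDuhamel 1 s v v t x)
    (hdiv : ∀ t < 0, VectorCalculus.IsDivFree (v t))
    (hpol : ∀ s < 0, ∀ y, ⟪curl (v s) y, EuclideanSpace.single 2 1⟫_ℝ = 0) {μ : ℝ → ℝ → ℝ} {μₜ t : ℝ}
    (ht : t < 0) (x : EuclideanSpace ℝ (Fin 3))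
    (hslope : ∀ᶠ z in 𝓝 ((t, x) : ℝ × EuclideanSpace ℝ (Fin 3)), ∀ b : Fin 3, b ≠ 2 →
      fderiv ℝ (v z.1) z.2 (EuclideanSpace.single 2 1) b = μ z.1 (z.2 2) * fderiv ℝ (v z.1) z.2 (EuclideanSpace.single b 1) 2)
    (hμx : ContDiff ℝ 2 (μ t)) (hμt : HasDerivAt (fun s => μ s (x 2)) μₜ t) {e : EuclideanSpace ℝ (Fin 3)} (he2 : e 2 = 0) :
    (1 - μ t (x 2)) *
        (deriv (fun s => fderiv ℝ (v s) x e 2) t + fderiv ℝ (fun y => fderiv ℝ (v t) y e 2) x (v t x)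
          - Δ (fun y => fderiv ℝ (v t) y e 2) x + fderiv ℝ (v t) x (fderiv ℝ (v t) x e) 2) =
      (μₜ + v t x 2 * deriv (μ t) (x 2) - deriv (deriv (μ t)) (x 2)) * fderiv ℝ (v t) x e 2
        - 2 * deriv (μ t) (x 2) * fderiv ℝ (fun y => fderiv ℝ (v t) y e 2) x (EuclideanSpace.single 2 1) := by
  have hVG := fderiv_equation_coord hrate hcont hmild hdiv ht x e 2
  have h0 := (timeHeightShear_pressure hrate hcont hmild hdiv hpol ht x hslope hμx hμt (b := 0) (by decide)).1
  have h1 := (timeHeightShear_pressure hrate hcont hmild hdiv hpol ht x hslope hμx hμt (b := 1) (by decide)).1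
  set F : EuclideanSpace ℝ (Fin 3) → EuclideanSpace ℝ (Fin 3) :=
    fun y => timeDerivWithin (Iio 0) v t y + convect (v t) (v t) y - Δ (v t) y with hF
  set E0 : EuclideanSpace ℝ (Fin 3) := EuclideanSpace.single 0 (1 : ℝ) with hE0
  set E1 : EuclideanSpace ℝ (Fin 3) := EuclideanSpace.single 1 (1 : ℝ) with hE1
  have he : e = e 0 • E0 + e 1 • E1 := PoloidalWindowDoorPoloidalWindowRigidityLeafUniformHFlat.horizontal_decomp' he2
  -- regularity of the slice and of `y ↦ ∂_b v₂(t,y)`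
  have hA : IsTypeIAncientMild C v := isTypeIAncientMild_of_class hrate hcont hmild hdiv
  have hs : ContDiff ℝ ∞ (v t) := hA.contDiff_slice ht
  have hcomp : ∀ a : EuclideanSpace ℝ (Fin 3), DifferentiableAt ℝ (fun y => fderiv ℝ (v t) y a 2) x := by
    intro a
    have hW : ContDiff ℝ ∞ (fun y => fderiv ℝ (v t) y a) := (hs.fderiv_right (m := ∞) (by norm_cast)).clm_apply contDiff_const
    have hfun : (fun y => fderiv ℝ (v t) y a 2) = (EuclideanSpace.proj (𝕜 := ℝ) (2 : Fin 3)) ∘ fun y => fderiv ℝ (v t) y a := by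
      funext y; simp
    rw [hfun]
    exact (ContinuousLinearMap.differentiableAt _).comp x ((hW.differentiable (by simp)) x)
  -- linearity in the direction `e`
  have hFe : fderiv ℝ F x e 2 = e 0 * fderiv ℝ F x E0 2 + e 1 * fderiv ℝ F x E1 2 := by
    conv_lhs => rw [he]
    rw [map_add, map_smul, map_smul, PiLp.add_apply, PiLp.smul_apply, PiLp.smul_apply, smul_eq_mul, smul_eq_mul]
  have hve : fderiv ℝ (v t) x e 2 = e 0 * fderiv ℝ (v t) x E0 2 + e 1 * fderiv ℝ (v t) x E1 2 := by
    conv_lhs => rw [he]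
    rw [map_add, map_smul, map_smul, PiLp.add_apply, PiLp.smul_apply, PiLp.smul_apply, smul_eq_mul, smul_eq_mul]
  have hge : fderiv ℝ (fun y => fderiv ℝ (v t) y e 2) x (EuclideanSpace.single 2 1) =
      e 0 * fderiv ℝ (fun y => fderiv ℝ (v t) y E0 2) x (EuclideanSpace.single 2 1) +
        e 1 * fderiv ℝ (fun y => fderiv ℝ (v t) y E1 2) x (EuclideanSpace.single 2 1) := by
    have hfun : (fun y => fderiv ℝ (v t) y e 2) = fun y => e 0 * fderiv ℝ (v t) y E0 2 + e 1 * fderiv ℝ (v t) y E1 2 := by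
      funext y
      conv_lhs => rw [he]
      rw [map_add, map_smul, map_smul, PiLp.add_apply, PiLp.smul_apply, PiLp.smul_apply, smul_eq_mul, smul_eq_mul]
    rw [hfun, (((hcomp E0).hasFDerivAt.const_mul (e 0)).fun_add ((hcomp E1).hasFDerivAt.const_mul (e 1))).fderiv]
    simp [smul_eq_mul]
  -- the (TH) pressure identity along `e`
  have key : (1 - μ t (x 2)) * fderiv ℝ F x e 2 =
      (μₜ + v t x 2 * deriv (μ t) (x 2) - deriv (deriv (μ t)) (x 2)) * fderiv ℝ (v t) x e 2
        - 2 * deriv (μ t) (x 2) * fderiv ℝ (fun y => fderiv ℝ (v t) y e 2) x (EuclideanSpace.single 2 1) := by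
    rw [hFe, hve, hge]
    linear_combination (e 0) * h0 + (e 1) * h1
  -- the velocity-gradient law
  have hsum : deriv (fun s => fderiv ℝ (v s) x e 2) t + fderiv ℝ (fun y => fderiv ℝ (v t) y e 2) x (v t x)
      - Δ (fun y => fderiv ℝ (v t) y e 2) x + fderiv ℝ (v t) x (fderiv ℝ (v t) x e) 2 = fderiv ℝ F x e 2 := by
    linarith [hVG]
  rw [hsum]
  exact key

/-- **The zeroth-order coupling in the web frame.**  For a horizontal unit vector `e` and any differentiable `V` (a slice `v(t,·)`):
`(DV[DV e])₂ = (⟨DV e⟩₀e₀ + ⟨DV e⟩₁e₁)·(DV e)₂ + (⟨DV e⟩₁e₀ − ⟨DV e⟩₀e₁)·(DV Je)₂ + (DV e)₂·(DV e₂)₂`, i.e. `P·g + Q·θ_ν + g·θ_z` with `P = ⟪DV e, e⟫`,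
`Q = ⟪DV e, Je⟫`, `g = ∂_eV₂`, `θ_ν = ∂_{Je}V₂`, `θ_z = ∂_zV₂`. -/
theorem coupling_frame (V : EuclideanSpace ℝ (Fin 3) → EuclideanSpace ℝ (Fin 3)) (x : EuclideanSpace ℝ (Fin 3)) {e : EuclideanSpace ℝ (Fin 3)}
    (he2 : e 2 = 0) (hunit : e 0 ^ 2 + e 1 ^ 2 = 1) :
    fderiv ℝ V x (fderiv ℝ V x e) 2 =
      (fderiv ℝ V x e 0 * e 0 + fderiv ℝ V x e 1 * e 1) * fderiv ℝ V x e 2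
        + (fderiv ℝ V x e 1 * e 0 - fderiv ℝ V x e 0 * e 1) * fderiv ℝ V x (Jvec e) 2
        + fderiv ℝ V x e 2 * fderiv ℝ V x e2 2 := by
  set w := fderiv ℝ V x e with hw
  conv_lhs => rw [frame_decomp he2 hunit w]
  rw [map_add, map_add, map_smul, map_smul, map_smul, PiLp.add_apply, PiLp.add_apply, PiLp.smul_apply, PiLp.smul_apply, PiLp.smul_apply,
    smul_eq_mul, smul_eq_mul, smul_eq_mul]

end Summit.NavierStokesRegularity.NavierStokesRegularity.Theorems.PoloidalWindowDoorLrcModEntireHorizDerivTransportLaw
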